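import Literature.Geometry.Lorentzian.LeviCivita
import Literature.Geometry.Lorentzian.EnergyCurrents
import Literature.Geometry.Lorentzian.Volume
import Literature.Geometry.Riemannian.RiemannianDistance
import HarnessLib

/-!
# The sharp logarithmic Sobolev inequality of a complete `Ric ≥ 0` four-manifold with Euclidean
# volume growth (Balogh–Kristály–Tripaldi; named fact)

Topic `Geometry/Riemannian`. Named fact wanted by line `fat-conical-core-avr-logsobolev` of crux
`EntropyRung.SubcylindricalExistence` (Summits/SmoothPoincare4, stmt-SmoothPoincare4-10871), where it
is the registered fact stub `stub_bktLogSobolevAVRFour` of the skeleton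
(`Cruxes/SubcylindricalExistence/Lines/fat_conical_core_avr_logsobolev.lean`): the ONE analytic input
from which the line's Euclidean exact-cone annulus floors (`helper_annulusConeFloor`, Theorems file
`EntropyRungSubcylindricalExistenceAnnulusConeFloor.lean`) and the core floor bridge
(`stub_floorBridge`, `EntropyRungSubcylindricalExistenceFloorBridge.lean`) are PROVED in the tree; both
take exactly this statement as their first hypothesis.

## Source, as printed

* Z. M. Balogh, A. Kristály, F. Tripaldi, *Sharp log-Sobolev inequalities in `CD(0,N)` spaces with
  applications*, J. Funct. Anal. 286 (2024) 110217 = arXiv:2210.15774, p. 3: "Given a metric measure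
  space `(X,d,m)` that satisfies the curvature-dimension condition `CD(0,N)` … the asymptotic volume
  ratio `AVR_m = lim_{r→∞} m(B(x,r))/(σ_N r^N)` … which is independent of the choice of `x ∈ X`", with
  `σ_N = π^{N/2}/Γ(N/2+1)` and `𝓛_{p,N} = (p/N)((p−1)/e)^{p−1}(σ_N Γ(N/p'+1))^{−p/N}` (p. 2);
  **Theorem 1.1** (p. 3): "Let `N, p > 1`, and `(X,d,m)` be a `CD(0,N)` space with `AVR_m > 0`. Then, for
  every `u ∈ W^{1,p}(X,d,m)` with `∫_X |u|^p dm = 1`, one has that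
  `∫_X |u|^p log |u|^p dm ≤ (N/p) log( 𝓛_{p,N} AVR_m^{−p/N} ∫_X |∇u|^p dm )`. In addition, the constant
  `𝓛_{p,N} AVR_m^{−p/N}` in (LSI) is sharp", and (p. 3, after the theorem): "In the case of a Riemannian
  manifold `(M,g)` (endowed with its canonical measure `dv_g`), one has `0 ≤ AVR_{dv_g} ≤ 1`".

## Rendering

The case `p = 2`, `N = n = 4` on a smooth manifold: `σ_4 = π²/2`, `Γ(3) = 2`, so
`𝓛_{2,4} = (1/2)(1/e)(σ_4 Γ(3))^{−1/2} = (2eπ)^{−1}` and (LSI) reads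
`∫ u² log u² ≤ 2 log( (2eπ)^{−1} θ^{−1/2} ∫ |∇u|² )`, `θ = AVR`. We state it in the equivalent
SCALE-FAMILY form free of the logarithm of an integral (the form Perelman's `𝒲`-functional consumes):
for every `τ > 0`,
`∫ u² log u² ≤ 4τ ∫ |∇u|²_g − log θ − 2 log(4πτ) − 4`,
which is (LSI) combined with `2 log Y = min_{A>0} (2Y/A − 2 + 2 log A)` at `Y = (2eπ√θ)^{−1}∫|∇u|²`,
`A = (4eπτ√θ)^{−1}` (so the family over `τ > 0` is EQUIVALENT to (LSI) whenever `∫|∇u|² > 0`, and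
`∫|∇u|² = 0` is impossible: `u` would be a compactly supported constant of unit `L²`-mass on a
noncompact manifold — `AVR > 0` forces infinite volume).
Data: a connected manifold `P` modelled on `EuclideanSpace ℝ (Fin 4)` (Hausdorff, second countable,
`T₃`, Borel); a `C^∞` Riemannian metric `h` with its Levi-Civita connection, COMPLETE in the form
"closed `h.edist`-balls are compact"; `Ric_h ≥ 0` on the diagonal; the asymptotic volume ratio
rendered as the hypothesis that `vol_h {y | d(x,y) ≤ r} / (π²/2 · r⁴) → θ` as `r → ∞` for every `x`,
with `θ > 0` (closed balls have the same limit ratio as open ones). A smooth complete Riemannian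
`n`-manifold with `Ric ≥ 0` and its volume measure is a `CD(0,n)` space (Sturm, von Renesse–Sturm;
Lott–Villani), smooth compactly supported functions lie in `W^{1,2}` and their minimal weak upper
gradient is the Riemannian gradient norm (Cheeger), so `|∇u|² = h.gradSq u`: the statement below is the
printed theorem specialised to this smooth setting. Test functions: `u` smooth with compact support
and `∫ u² dV_h = 1` (Bochner integral; `u²`, `u² log u²` and `h.gradSq u` are continuous with compact
support, hence integrable — no junk values). Empty `P` is excluded by `ConnectedSpace`.

## What is NOT here

The proof (sharp isoperimetry in `CD(0,N)` after Balogh–Kristály / Brendle, symmetrisation to the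
one-dimensional model `([0,∞), N AVR r^{N−1} dr)`, and the weighted one-dimensional log-Sobolev
inequality), the cases `p ≠ 2`, `N ≠ 4`, nonsmooth `CD(0,N)` spaces, and the sharpness clause.

## References

* [BaloghKristalyTripaldi2024] Z. M. Balogh, A. Kristály, F. Tripaldi, J. Funct. Anal. 286 (2024)
  110217 (arXiv:2210.15774): Thm. 1.1 (p. 3), constants p. 2. READ (held text, pp. 2–3).
-/

noncomputable section

open Bundle Set Filter MeasureTheory Manifold
open scoped ContDiff Topology ENNReal NNReal

namespace Literature.Geometry.Riemannian

open Lorentzian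

/-- **Sharp logarithmic Sobolev inequality of a complete `Ric ≥ 0` four-manifold with Euclidean volume
growth** (Balogh–Kristály–Tripaldi 2024, Thm. 1.1 with `p = 2`, `N = 4`, in scale-family form).
Data: a connected manifold `P` modelled on `EuclideanSpace ℝ (Fin 4)`, a complete Riemannian metric `h`
(closed `h.edist`-balls compact) with its Levi-Civita connection and `Ric_h ≥ 0` on the diagonal, and
`θ > 0` the asymptotic volume ratio: `vol_h {d(x,·) ≤ r} / (π² r⁴/2) → θ` as `r → ∞`, for every `x`.
Conclusion: for every smooth compactly supported `u` with `∫ u² dV_h = 1` and every `τ > 0`,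
`∫ u² log u² dV_h ≤ 4τ ∫ |∇u|²_h dV_h − log θ − 2 log (4πτ) − 4`
(the printed `∫u² log u² ≤ 2 log((2eπ)^{−1} θ^{−1/2} ∫|∇u|²)`, `𝓛_{2,4} = (2eπ)^{−1}`, combined with
`2 log Y = min_{A>0}(2Y/A − 2 + 2 log A)`; see the module docstring for the rendering and the junk-value
audit). Users take `(h : sharpLogSobolevAVR_four)`; first users: `helper_annulusConeFloor` and
`stub_floorBridge` of line `fat-conical-core-avr-logsobolev` of crux `EntropyRung.SubcylindricalExistence`
(Summits/SmoothPoincare4), which take this statement verbatim as their first hypothesis.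
-- TODO(general form): `p, N > 1`, nonsmooth `CD(0,N)` metric measure spaces, `u ∈ W^{1,p}`, and the
-- sharpness of the constant `𝓛_{p,N} AVR^{−p/N}`.
[cite: BaloghKristalyTripaldi2024, Thm. 1.1 (p. 3)] -/
def sharpLogSobolevAVR_four : Prop :=
  ∀ (P : Type) [TopologicalSpace P] [T2Space P] [SecondCountableTopology P]
    [ChartedSpace (EuclideanSpace ℝ (Fin 4)) P] [IsManifold (𝓡 4) ∞ P] [ConnectedSpace P]
    [T3Space P] [MeasurableSpace P] [BorelSpace P]
    (h : PseudoRiemannianMetric (𝓡 4) ∞ (EuclideanSpace ℝ (Fin 4)) (TangentSpace (𝓡 4) : P → Type _))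
    [h.HasLeviCivita] (hh : h.IsRiemannian) (θ : ℝ),
    (∀ (x : P) (r : NNReal), IsCompact {y : P | h.edist hh x y ≤ r}) →
    (∀ (x : P) (X : TangentSpace (𝓡 4) x), 0 ≤ h.ricci x X X) → 0 < θ →
    (∀ x : P, Tendsto (fun r : ℝ ↦
      ((riemannianMeasure (h.toContMDiffRiemannianMetric hh))
        {y : P | h.edist hh x y ≤ ENNReal.ofReal r}).toReal / (Real.pi ^ 2 / 2 * r ^ 4))
      atTop (𝓝 θ)) →
    ∀ u : P → ℝ, ContMDiff (𝓡 4) 𝓘(ℝ, ℝ) ∞ u → HasCompactSupport u →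
      ∫ x, (u x) ^ 2 ∂(riemannianMeasure (h.toContMDiffRiemannianMetric hh)) = 1 →
      ∀ τ : ℝ, 0 < τ →
        ∫ x, (u x) ^ 2 * Real.log ((u x) ^ 2) ∂(riemannianMeasure (h.toContMDiffRiemannianMetric hh)) ≤
          4 * τ * ∫ x, h.gradSq u x ∂(riemannianMeasure (h.toContMDiffRiemannianMetric hh))
            - Real.log θ - 2 * Real.log (4 * Real.pi * τ) - 4

end Literature.Geometry.Riemannian

end
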